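import Summits.QuantumAdvantage.QuantumAdvantage.Theorems.CubicForrelationNearExactIsExactFourteenSecondDigits
import Summits.QuantumAdvantage.QuantumAdvantage.Theorems.CubicForrelationNearExactIsExactTwelveSecondTypeO
import Summits.QuantumAdvantage.QuantumAdvantage.Theorems.CubicForrelationNearExactIsExactTwoModSixPrep

/-!
# Crux `CubicForrelation.NearExactIsExact` (stmt-QuantumAdvantage-14043) — n = 14 at the SECOND boundary `15/16`, type O with a
  quadratic digit of rank `≤ 2`: the configuration `E ≠ ∅` never reaches `Φ = 15/16`

Certificate seat `b2b-cforr-cert` (gen 9).  HONEST FRAMING: a theorem about cubic Boolean functions on 14 bits (finite slice `n = 14`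
of the crux; one branch of the case analysis of `Φ ≥ 15/16 ⇒ Φ = 1`, the `n ≡ 2 (mod 6)` instance of the second dyadic boundary,
open after gens 6/8) — NOT summit progress.

Setting (`W_g = 32u`, `u` odd = type O, `s = (−1)^f`, `τ = u − 4s`, budget `Σ τ² = 2¹⁹(1 − Φ) ≤ 2¹⁵` at `Φ ≥ 15/16`): the digits
`d₁ = [⌊u/2⌋ odd]` (quadratic) and `d₂ = [⌊u/4⌋ odd]` control the cost, `τ² ≥ 1 + 8·[d₁ = d₂]` (`tw12_pt`, the same integer
inequality as at `n = 12`).  When the radical `R` of `d₁` has `#R ≥ 2¹²` (rank `d₁ ≤ 2`) the digit `d₂` is cubic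
(`fo_digitTwo_cubic`, file `…FourteenSecondDigits`), so `E = {d₁ = d₂} ≠ ∅` has `#E ≥ 2¹¹` (Reed–Muller), the budget is spent
exactly, `E` is an 11-flat (`mw_flat_of_minweight`), `τ = (−1)^{d₁}(1 − 4·1_E)`, and the period engine (`fp_l1_sq_mul_le` with `R`,
resp. `R ∩ V_E` of size `≥ 2⁹` by `fo_card_mul_le_inter`) gives `Σ|τ̂| ≤ 2¹⁵ + 4·2¹⁵ < 2¹⁹ = Σ_y (−1)^{g(y)} τ̂(y)` (`tms_pairing`).
`fo_lowrank_false`: for EVERY Boolean `f`.  (The complementary branches — `E = ∅`, rank `d₁ ≥ 4`, the even levels, the bent value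
`15/16` — are the remaining case list for `θ₁₄ < 15/16`.)

References: J. Ax (1964) / R. J. McEliece (1972); MacWilliams–Sloane (1977) Ch. 13–15; R. O'Donnell (2014) §3.3; C. Carlet (2021)
§5.2.  Everything below is proved from Mathlib and the tree; axioms are the standard three.
-/

set_option linter.dupNamespace false -- D-0017: single-problem summit ⇒ `QuantumAdvantage.QuantumAdvantage` by design

noncomputable section

namespace Summit.QuantumAdvantage.QuantumAdvantage.Theorems.CubicForrelation.NearExactIsExact

open Finset
open Literature.Computability.QuantumComplexity
open Literature.Computability.QuantumComplexity.BuzetChailloux (bxor zeroVec bxor_bxor_cancel_left bxor_zeroVec zeroVec_bxor bxor_comm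
  bxor_self)
open Literature.Computability.QuantumComplexity.DerivativeWalsh (W)

/-! ### The branch `rank d₁ ≤ 2`, `E ≠ ∅` -/

/-- **Type O with `rank d₁ ≤ 2` and `E = {d₁ = d₂} ≠ ∅` never reaches `Φ = 15/16` on 14 bits.**  For a cubic `g : 𝔽₂¹⁴ → 𝔽₂` with
`W_g = 32u`, all `u(x)` odd, first-digit radical of size `≥ 2¹²` and some `x` with `d₁(x) = d₂(x)`, and for EVERY Boolean `f`:
`Φ(f,g) ≥ 15/16` is impossible.  (Budget `Σ(u − 4s)² ≤ 2¹⁵` vs cost `1 + 8·1_E`, `#E ≥ 2¹¹` since `1 ⊕ d₁ ⊕ d₂` is cubic; so `E` is an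
11-flat, `u − 4s = (−1)^{d₁}(1 − 4·1_E)`, and the period engine bounds `Σ|τ̂| ≤ 2¹⁵ + 2¹⁷ < 2¹⁹ = Σ_y (−1)^{g(y)} τ̂(y)`.)  Finite-slice
statement; NOT summit progress. [this work] -/
theorem fo_lowrank_false (f g : (Fin (7 + 7) → Bool) → Bool) (hg : IsDegLeFun 3 g)
    (u : (Fin (7 + 7) → Bool) → ℤ) (hu : ∀ x, W (fun y => signOf (g y)) x = (2 : ℝ) ^ 5 * (u x : ℝ))
    (hodd : ∀ x, Odd (u x))
    (hrad : 2 ^ 12 ≤ #(univ.filter fun a : Fin (7 + 7) → Bool => ∀ b,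
      (decide (Odd (u zeroVec / 2)) ^^ decide (Odd (u a / 2)) ^^ decide (Odd (u b / 2)) ^^ decide (Odd (u (bxor a b) / 2))) = false))
    (hEne : ∃ x, (Odd (u x / 2) ↔ Odd (u x / 2 / 2)))
    (hΦ : (15 / 16 : ℝ) ≤ forrelation f g) : False := by
  classical
  have hu' : ∀ x, W (fun y => signOf (g y)) x = (2 : ℝ) ^ (2 * 2 + 1) * (u x : ℝ) := fun x => (hu x).trans (by norm_num)
  have hd1 : IsDegLeFun 2 (fun x => decide (Odd (u x / 2))) := fd_digitOne g u hg hu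
  have hd2 : IsDegLeFun 3 (fun x => decide (Odd (u x / 2 / 2))) := fo_digitTwo_cubic g u hg hu hrad
  set R := univ.filter (fun a : Fin (7 + 7) → Bool => ∀ b,
      (decide (Odd (u zeroVec / 2)) ^^ decide (Odd (u a / 2)) ^^ decide (Odd (u b / 2)) ^^ decide (Odd (u (bxor a b) / 2))) = false)
    with hRdef
  have h0R : zeroVec ∈ R := by
    refine mem_filter.2 ⟨mem_univ _, fun b => ?_⟩
    rw [zeroVec_bxor]
    cases decide (Odd (u zeroVec / 2)) <;> cases decide (Odd (u b / 2)) <;> rfl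
  have haddR : ∀ a ∈ R, ∀ a' ∈ R, bxor a a' ∈ R := by
    intro a ha a' ha'
    refine mem_filter.2 ⟨mem_univ _, fun b => ?_⟩
    rw [es_B_add_left (fun x => decide (Odd (u x / 2))) hd1 a a' b, (mem_filter.1 ha).2 b, (mem_filter.1 ha').2 b]
    rfl
  -- radical vectors are periods up to sign of `d₁`
  have hDR : ∀ a ∈ R, ∀ x : Fin (7 + 7) → Bool,
      decide (Odd (u (bxor x a) / 2)) = (decide (Odd (u x / 2)) ^^ (decide (Odd (u zeroVec / 2)) ^^ decide (Odd (u a / 2)))) := by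
    intro a ha x
    have h := (mem_filter.1 ha).2 x
    rw [bxor_comm] at h
    revert h
    cases decide (Odd (u zeroVec / 2)) <;> cases decide (Odd (u a / 2)) <;> cases decide (Odd (u x / 2)) <;>
      cases decide (Odd (u (bxor x a) / 2)) <;> decide
  -- the set `E = {d₁ = d₂}` and its degree
  set E := univ.filter (fun x : Fin (7 + 7) → Bool => (Odd (u x / 2) ↔ Odd (u x / 2 / 2))) with hEdef
  have hmemE : ∀ x, x ∈ E ↔ (Odd (u x / 2) ↔ Odd (u x / 2 / 2)) := fun x => by simp [hEdef]
  have hdegE : IsDegLeFun (2 + 1) (fun x => (decide (Odd (u x / 2)) ^^ decide (Odd (u x / 2 / 2))) ^^ true) :=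
    tb_isDegLeFun_xor_const (bb_isDegLeFun_bxor (hd1.mono (by norm_num)) hd2) true
  have hsetE : (univ.filter fun x : Fin (7 + 7) → Bool =>
      ((decide (Odd (u x / 2)) ^^ decide (Odd (u x / 2 / 2))) ^^ true) = true) = E := by
    rw [hEdef]
    apply filter_congr
    intro x _
    by_cases h1 : Odd (u x / 2) <;> by_cases h2 : Odd (u x / 2 / 2) <;> simp [h1, h2]
  have hne : ∃ x, ((decide (Odd (u x / 2)) ^^ decide (Odd (u x / 2 / 2))) ^^ true) = true := by
    obtain ⟨x, hx⟩ := hEne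
    refine ⟨x, ?_⟩
    by_cases h1 : Odd (u x / 2) <;> by_cases h2 : Odd (u x / 2 / 2) <;> simp [h1, h2] at hx ⊢
  have hrm := bb_rmWeight_holds (7 + 7) 3 _ hdegE hne
  rw [hsetE] at hrm
  have hEge : 2048 ≤ #E := by norm_num at hrm; omega
  -- budget and the pointwise cost
  have hbud := fl_budget5 f g u hu
  have hT : (∑ x, (u x - 4 * sZ (f x)) ^ 2 : ℤ) ≤ 32768 := by
    have h' : ((∑ x, (u x - 4 * sZ (f x)) ^ 2 : ℤ) : ℝ) ≤ 32768 := by rw [hbud]; nlinarith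
    exact_mod_cast h'
  have hsumE : (∑ x, (if (Odd (u x / 2) ↔ Odd (u x / 2 / 2)) then 1 else 0 : ℤ)) = #E := by rw [sum_boole]
  have hnonneg : ∀ x, 0 ≤ (u x - 4 * sZ (f x)) ^ 2 - (1 + 8 * (if (Odd (u x / 2) ↔ Odd (u x / 2 / 2)) then 1 else 0 : ℤ)) :=
    fun x => by have := tw12_pt (u x) (sZ (f x)) (hodd x) (tp_sZ_cases (f x)); linarith
  have hsum0 : ∑ x, ((u x - 4 * sZ (f x)) ^ 2 - (1 + 8 * (if (Odd (u x / 2) ↔ Odd (u x / 2 / 2)) then 1 else 0 : ℤ))) = 0 := by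
    refine le_antisymm ?_ (sum_nonneg fun x _ => hnonneg x)
    rw [sum_sub_distrib, sum_add_distrib, ← mul_sum, hsumE, sum_const, card_univ, Fintype.card_fun, Fintype.card_bool,
      Fintype.card_fin]
    have : (2048 : ℤ) ≤ #E := by exact_mod_cast hEge
    norm_num
    linarith
  have hpt : ∀ x, (u x - 4 * sZ (f x)) ^ 2 = 1 + 8 * (if (Odd (u x / 2) ↔ Odd (u x / 2 / 2)) then 1 else 0 : ℤ) :=
    fun x => by have := (sum_eq_zero_iff_of_nonneg fun y _ => hnonneg y).1 hsum0 x (mem_univ x); linarith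
  have hEcard : #E = 2048 := by
    have hT' : (16384 : ℤ) + 8 * #E ≤ 32768 := by
      have e : (∑ x, (u x - 4 * sZ (f x)) ^ 2 : ℤ) = 16384 + 8 * #E := by
        rw [sum_congr rfl fun x _ => hpt x, sum_add_distrib, ← mul_sum, hsumE, sum_const, card_univ, Fintype.card_fun,
          Fintype.card_bool, Fintype.card_fin]
        norm_num
      rw [← e]; exact hT
    have hle : #E ≤ 2048 := by
      have : (#E : ℤ) ≤ 2048 := by linarith
      exact_mod_cast this
    omega
  have hΦeq : forrelation f g = 15 / 16 := by
    have e : (∑ x, (u x - 4 * sZ (f x)) ^ 2 : ℤ) = 32768 := by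
      rw [sum_congr rfl fun x _ => hpt x, sum_add_distrib, ← mul_sum, hsumE, sum_const, card_univ, Fintype.card_fun,
        Fintype.card_bool, Fintype.card_fin, hEcard]
      norm_num
    have h : ((∑ x, (u x - 4 * sZ (f x)) ^ 2 : ℤ) : ℝ) = 32768 := by exact_mod_cast e
    rw [hbud] at h
    linarith
  -- the residual
  have hτ1 : ∀ x, x ∉ E → u x - 4 * sZ (f x) = sZ (decide (Odd (u x / 2))) := by
    intro x hx
    have h := hpt x
    rw [if_neg (fun h' => hx ((hmemE x).2 h'))] at h
    have h1 : (u x - 4 * sZ (f x)) * (u x - 4 * sZ (f x)) = 1 := by rw [← pow_two]; linarith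
    exact sp_tau_one (mul_self_eq_one_iff.1 h1)
  have hτ3 : ∀ x, x ∈ E → u x - 4 * sZ (f x) = -3 * sZ (decide (Odd (u x / 2))) := by
    intro x hx
    have h := hpt x
    rw [if_pos ((hmemE x).1 hx)] at h
    exact sp_tau_three (by linarith)
  -- `E` is an 11-flat
  have hmwE := mw_flat_of_minweight 2 _ hdegE (by rw [hsetE, hEcard]; norm_num)
  rw [hsetE] at hmwE
  obtain ⟨h0E, haddE, hcardVE, hcosetE⟩ := hmwE
  set VE := univ.filter (fun a : Fin (7 + 7) → Bool => ∀ x,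
    ((decide (Odd (u (bxor x a) / 2)) ^^ decide (Odd (u (bxor x a) / 2 / 2))) ^^ true) =
      ((decide (Odd (u x / 2)) ^^ decide (Odd (u x / 2 / 2))) ^^ true)) with hVE
  rw [hEcard] at hcardVE
  have hEpos : 0 < #E := by rw [hEcard]; norm_num
  obtain ⟨xE, hxE⟩ : E.Nonempty := card_pos.1 hEpos
  have hSE : E = VE.image (bxor xE) := hcosetE xE (by
    have h := (hmemE xE).1 hxE
    by_cases h1 : Odd (u xE / 2)
    · have h2 : Odd (u xE / 2 / 2) := h.1 h1
      simp [h1, h2]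
    · have h2 : ¬ Odd (u xE / 2 / 2) := fun h' => h1 (h.2 h')
      simp [h1, h2])
  -- the period engine, part 1: `A₁ = (−1)^{d₁}` with the radical `R`
  set A₁ : (Fin (7 + 7) → Bool) → ℝ := fun x => signOf (decide (Odd (u x / 2))) with hA₁
  have h1b := fp_l1_sq_mul_le A₁ univ R (fun x _ => by simp only [A₁]; unfold signOf; split_ifs <;> simp)
    (fun x hx => absurd (mem_univ x) hx) h0R haddR (fun a ha => by
      refine ⟨signOf (decide (Odd (u zeroVec / 2)) ^^ decide (Odd (u a / 2))), ?_, fun x => ?_⟩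
      · unfold signOf; split_ifs <;> simp
      · simp only [A₁]; rw [hDR a ha x, signOf_xor]; ring)
  rw [card_univ, Fintype.card_fun, Fintype.card_bool, Fintype.card_fin] at h1b
  have hrad' : 4096 ≤ #R := by norm_num at hrad; exact hrad
  have hRr : (4096 : ℝ) ≤ #R := by exact_mod_cast hrad'
  have hX : ∑ y, |W A₁ y| ≤ 32768 := by
    have hnn : 0 ≤ ∑ y, |W A₁ y| := sum_nonneg fun y _ => abs_nonneg _
    push_cast at h1b
    have h2 : (∑ y, |W A₁ y|) ^ 2 * 4096 ≤ (∑ y, |W A₁ y|) ^ 2 * #R := mul_le_mul_of_nonneg_left hRr (sq_nonneg _)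
    nlinarith
  -- part 2: `A₂ = 1_E·(−1)^{d₁}` with the periods `R ∩ V_E`
  set A₂ : (Fin (7 + 7) → Bool) → ℝ := fun x => if x ∈ E then signOf (decide (Odd (u x / 2))) else 0 with hA₂
  have hRV := fo_card_mul_le_inter R VE haddR haddE
  rw [hcardVE] at hRV
  norm_num at hRV
  have hR2 : 512 ≤ #(R ∩ VE) := by omega
  have h0R2 : zeroVec ∈ R ∩ VE := mem_inter.2 ⟨h0R, h0E⟩
  have haddR2 : ∀ a ∈ R ∩ VE, ∀ b ∈ R ∩ VE, bxor a b ∈ R ∩ VE := fun a ha b hb =>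
    mem_inter.2 ⟨haddR a (mem_inter.1 ha).1 b (mem_inter.1 hb).1, haddE a (mem_inter.1 ha).2 b (mem_inter.1 hb).2⟩
  have h2b := fp_l1_sq_mul_le A₂ E (R ∩ VE) (fun x hx => by
      simp only [A₂, if_pos hx]; unfold signOf; split_ifs <;> simp) (fun x hx => by simp only [A₂, if_neg hx]) h0R2 haddR2
    (fun a ha => by
      refine ⟨signOf (decide (Odd (u zeroVec / 2)) ^^ decide (Odd (u a / 2))), ?_, fun x => ?_⟩
      · unfold signOf; split_ifs <;> simp
      · by_cases hx : x ∈ E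
        · have hxa : bxor x a ∈ E := fl1_coset_vadd haddE hSE hx (mem_inter.1 ha).2
          simp only [A₂, if_pos hx, if_pos hxa]; rw [hDR a (mem_inter.1 ha).1 x, signOf_xor]; ring
        · have hxa : bxor x a ∉ E := fl1_coset_out' haddE hSE hx (mem_inter.1 ha).2
          simp only [A₂, if_neg hx, if_neg hxa, mul_zero])
  rw [hEcard] at h2b
  have hR2r : (512 : ℝ) ≤ #(R ∩ VE) := by exact_mod_cast hR2
  have hY : ∑ y, |W A₂ y| ≤ 32768 := by
    have hnn : 0 ≤ ∑ y, |W A₂ y| := sum_nonneg fun y _ => abs_nonneg _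
    push_cast at h2b
    have h2 : (∑ y, |W A₂ y|) ^ 2 * 512 ≤ (∑ y, |W A₂ y|) ^ 2 * #(R ∩ VE) := mul_le_mul_of_nonneg_left hR2r (sq_nonneg _)
    nlinarith
  -- decomposition and pairing
  have hdecomp : (fun x => (u x : ℝ) - (2 : ℝ) ^ 2 * signOf (f x)) = fun x => A₁ x + (-4) * A₂ x := by
    funext x
    have e : (u x : ℝ) - (2 : ℝ) ^ 2 * signOf (f x) = (((u x - 4 * sZ (f x) : ℤ)) : ℝ) := by push_cast; rw [tp_sZ_cast]; ring
    rw [e]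
    by_cases hx : x ∈ E
    · simp only [A₁, A₂, if_pos hx]; rw [hτ3 x hx]; push_cast; rw [tp_sZ_cast]; ring
    · simp only [A₁, A₂, if_neg hx]; rw [hτ1 x hx, tp_sZ_cast]; ring
  have hpair := tms_pairing 2 f g u hu'
  rw [hΦeq, hdecomp] at hpair
  have e2 : ∀ y, signOf (g y) * W (fun x => A₁ x + (-4) * A₂ x) y =
      signOf (g y) * W A₁ y + (-4) * (signOf (g y) * W A₂ y) := fun y => by
    rw [sp_W_add, fl1_W_smul]; ring
  rw [sum_congr rfl fun y _ => e2 y, sum_add_distrib, ← mul_sum] at hpair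
  have hP1 : ∑ y, signOf (g y) * W A₁ y ≤ ∑ y, |W A₁ y| := fl1_pairing_le_l1 g (W A₁)
  have hP2 : |∑ y, signOf (g y) * W A₂ y| ≤ ∑ y, |W A₂ y| :=
    (abs_sum_le_sum_abs _ _).trans (sum_le_sum fun y _ => by
      rw [abs_mul]; unfold signOf; split_ifs <;> norm_num)
  have hP2' := (abs_le.1 hP2).1
  have h23 : (2 : ℝ) ^ (10 * 2 + 3) * (1 - 15 / 16) = 524288 := by norm_num
  rw [h23] at hpair
  linarith

end Summit.QuantumAdvantage.QuantumAdvantage.Theorems.CubicForrelation.NearExactIsExact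

end
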